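import Mathlib
import HarnessLib
import Literature.Computability.AlgebraicComplexity.DiPatternExpressions
import Literature.Computability.AlgebraicComplexity.DawarWilsenach2025Thm71
import Summits.ValiantsHypothesis.ValiantsHypothesis.Theorems.MonotoneRestorationOrbitRestorationQPPerNotNarrow
import Summits.ValiantsHypothesis.ValiantsHypothesis.Theorems.MonotoneRestorationOrbitRestorationLinearVolumeQPDiHomPolyClose
import Summits.ValiantsHypothesis.ValiantsHypothesis.Theorems.MonotoneRestorationOrbitCompressionQPDiNarrowToOrbit
import Summits.ValiantsHypothesis.ValiantsHypothesis.Theorems.MonotoneRestorationOrbitCompressionQPReynoldsDescentFalse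

/-!
# Route MonotoneRestoration — asides `OrbitCompressionQP` (stmt-ValiantsHypothesis-18332) and
# `OrbitRestorationLinearVolumeQP` (stmt-18294): THE PERMANENT IS NOT ONE-SORTEDLY NARROW (unconditional), and
# the one-sorted narrow span is NOT Reynolds-stable at any polylogarithmic loss

`…OrbitCompressionQPReynoldsDescentFalse.lean` (p831166) refuted REYNOLDS qp-descent — the permanent lies in the
Reynolds image of the treewidth-ZERO one-sorted span — and recorded what qp-descent (S1c, the common VH-free residue of
the registered lines of both asides) predicts instead: `per_n ∉ U_c(n) = span{dihom_{D,n} : tw D ≤ (log₂ n + c)^c}` for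
some `n`, every `c`.  THIS FILE PROVES THAT PREDICTION UNCONDITIONALLY, by the one-sorted twin of the argument of
`OrbitRestorationQPHomPolyClose.perPoly_not_mem_narrowSpan`:

* `qpOrbit_of_mem_diNarrowSpan` — **one-sorted span-narrowness gives quasi-polynomial orbits** (no symmetry or `VP`
  hypothesis): a family lying at every level in `U_c(n)` is, from level `1` on, ONE closed one-sorted expression with
  `(log₂ n + c)^c + 1` labels (one-sorted K2, `DiHomPolyClose.diNarrowExpression_of_mem_diNarrowSpan`), hence has
  SQUARE-symmetric circuits of orbit size `≤ 2^{(log₂ n + c')^{c'}}` (`NarrowToOrbit.qpOrbit_of_diNarrowExpression`);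
* ★★ `perPoly_not_mem_diNarrowSpan` — **for every `c` some `per_n` lies OUTSIDE the one-sorted narrow span `U_c(n)`**
  (Dawar–Wilsenach 2025 Thm 7.1, square-symmetric orbit form, PROVED in the tree: `2^{εn} ≤ ORB` infinitely often,
  versus `(log₂ n + c')^{c'} < εn`); i.e. the one-sorted homomorphism expansion of the permanent (cycle covers)
  charges directed patterns of super-polylogarithmic treewidth infinitely often;
* ★ `exists_loopPattern_reynolds_not_mem_diNarrowSpan` — **the one-sorted narrow span is not Reynolds-stable, at any
  polylogarithmic loss**: for every `c` there are a level `n` and a treewidth-`0` LOOP pattern (a product of diagonal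
  power sums, a member of `U_0(n)`) whose `Sym_n × Sym_n` Reynolds sum is NOT in `U_c(n)` (with
  `ReynoldsDescentFalse.perPoly_mem_of_reynolds_loopPatterns_mem`); `not_reynolds_diNarrowSpan_stable` — packaged.

MEANING FOR THE TWO LINES (honest label).  Matrix-symmetrisation leaves the narrow world on BOTH sides: `R(U_0(n))`
is contained neither in the bipartite narrow span `W_{c'}(n)` (p831166) nor in the one-sorted narrow span `U_{c'}(n)`
(this file), for any `c'`.  So in S1c — "`MatSym ∩ U_c(n) ⊆ W_{c'}(n)`" — the intersection with `MatSym` cannot be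
replaced by the Reynolds projection, and every proof must use the given narrow one-sorted expansion of `p` itself.
The calibration pair (bipartite: `perPoly_not_mem_narrowSpan`; one-sorted: `perPoly_not_mem_diNarrowSpan`) is now
complete and consistent with S1c.  S1c, the registered stubs, R1, the asides and VP ≠ VNP are NOT moved; def-free
helper (`--supports stmt-ValiantsHypothesis-18332`); nothing here is a named fact.

References: Dawar–Wilsenach 2025 (Theory of Computing 21) Thm 7.1; Dawar–Pago–Seppelt 2025 (arXiv:2502.06740) §5, §7
p. 45, Remark p. 17; Dwivedi–Pago–Seppelt 2026 (arXiv:2601.09343) Outlook Q3.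
-/

noncomputable section

open scoped Classical

-- `Summit.ValiantsHypothesis.ValiantsHypothesis.…` is the tree's single-conjunct layout (Sub = Summit).
set_option linter.dupNamespace false

namespace Summit.ValiantsHypothesis.ValiantsHypothesis.Theorems

namespace PerNotDiNarrow

open Literature.Computability.AlgebraicComplexity MvPolynomial Filter
open Literature.Combinatorics.SimpleGraph (treewidth)

/-- **One-sorted span-narrowness gives quasi-polynomial square-symmetric orbits** (no `VP`, no symmetry
hypothesis): if every `f n` lies in the span of the one-sorted homomorphism polynomials `dihom_{D,n}` of directed
looped patterns of treewidth `≤ (log₂ n + c)^c`, then `f` has square-symmetric circuits of orbit size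
`≤ 2^{(log₂ n + c')^{c'}}` for one `c'` and all `n` (one-sorted K2 + the value-derivation orbit bound).
[cite: DawarPagoSeppelt2025, §5 (proof of Thm 5.3) and §7 (p. 45)] -/
theorem qpOrbit_of_mem_diNarrowSpan (f : (n : ℕ) → MvPolynomial (Fin n × Fin n) ℂ) (c : ℕ)
    (hc : ∀ n : ℕ, f n ∈ Submodule.span ℂ {q : MvPolynomial (Fin n × Fin n) ℂ |
        ∃ (a : ℕ) (D : Multiset (Fin a × Fin a)),
          treewidth (SimpleGraph.fromRel fun u v : Fin a => ∃ e ∈ D, u = e.1 ∧ v = e.2) ≤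
            (Nat.log 2 n + c) ^ c ∧ q = diHomPoly D n ℂ}) :
    ∃ c' : ℕ, ∀ n : ℕ, ∃ (G : Type) (_ : Fintype G)
      (C : LabelledArithCircuit ℂ (Fin n × Fin n) Unit G),
      C.IsSymmetric (Equiv.Perm (Fin n)) ∧ C.eval (C.output ()) = f n ∧
      C.orbitSize (Equiv.Perm (Fin n)) ≤ 2 ^ ((Nat.log 2 n + c') ^ c') := by
  refine NarrowToOrbit.qpOrbit_of_diNarrowExpression f ⟨c + 3, fun n hn => ?_⟩
  obtain ⟨e, he⟩ :=
    DiHomPolyClose.diNarrowExpression_of_mem_diNarrowSpan hn ((Nat.log 2 n + c) ^ c) (f n) (hc n)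
  -- label budget `n^(W+1) ≤ 2^((log₂ n + c + 3)^(c + 3))` (the arithmetic of `…DiNarrowSpanTight`)
  have hbudget : n ^ ((Nat.log 2 n + c) ^ c + 1) ≤ 2 ^ ((Nat.log 2 n + (c + 3)) ^ (c + 3)) :=
    le_trans (le_trans (Nat.pow_le_pow_left (Nat.le_succ n) _)
      (Nat.pow_le_pow_right (Nat.succ_pos n) (by omega))) (narrowExpansion_orbit_bound n c)
  exact ⟨(Nat.log 2 n + c) ^ c + 1, e, hbudget, he⟩

/-- ★★ **THE PERMANENT IS NOT ONE-SORTEDLY NARROW.**  For no constant `c` does every `per_n` lie in the span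
`U_c(n)` of the one-sorted homomorphism polynomials `dihom_{D,n}` of directed looped patterns of treewidth
`≤ (log₂ n + c)^c`: the one-sorted (cycle-cover) homomorphism expansion of the permanent charges patterns of
super-polylogarithmic treewidth infinitely often.  One-sorted narrowness ⇒ square-symmetric orbits
`≤ 2^{(log₂ n + c')^{c'}}` (`qpOrbit_of_mem_diNarrowSpan`) versus Dawar–Wilsenach 2025 Thm 7.1 (PROVED in the
tree, `DawarWilsenach2025_thm71_holds`). [cite: DawarWilsenach2025, Thm. 7.1 (p. 18)] -/
theorem perPoly_not_mem_diNarrowSpan (c : ℕ) :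
    ¬ ∀ n : ℕ, perPoly (Fin n) ℂ ∈ Submodule.span ℂ {q : MvPolynomial (Fin n × Fin n) ℂ |
        ∃ (a : ℕ) (D : Multiset (Fin a × Fin a)),
          treewidth (SimpleGraph.fromRel fun u v : Fin a => ∃ e ∈ D, u = e.1 ∧ v = e.2) ≤
            (Nat.log 2 n + c) ^ c ∧ q = diHomPoly D n ℂ} := by
  intro h
  obtain ⟨c', hc'⟩ := qpOrbit_of_mem_diNarrowSpan (fun n => perPoly (Fin n) ℂ) c h
  choose G inst C hCsymm hCeval hCorb using hc'
  obtain ⟨ε, hε, hfreq⟩ := @DawarWilsenach2025_thm71_holds ℂ _ _ G inst C hCsymm hCeval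
  obtain ⟨n₀, key⟩ := MonotoneRestorationQP.Negative.polylog_pow_lt_linear c' hε
  obtain ⟨n, hle, hn⟩ := (hfreq.and_eventually (eventually_ge_atTop n₀)).exists
  have horb : (((C n).orbitSize (Equiv.Perm (Fin n)) : ℕ) : ℝ) ≤
      (2 : ℝ) ^ (((Nat.log 2 n + c') ^ c' : ℕ) : ℝ) := by
    rw [Real.rpow_natCast]
    exact_mod_cast hCorb n
  have hlt : (2 : ℝ) ^ (((Nat.log 2 n + c') ^ c' : ℕ) : ℝ) < (2 : ℝ) ^ (ε * n) := by
    apply (Real.rpow_lt_rpow_left_iff one_lt_two).2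
    have := key n hn
    push_cast at this ⊢
    exact this
  exact absurd (hle.trans horb) (not_le.mpr hlt)

/-- The family form: **`U`-narrowness minus nothing fails at the permanent** — "every matrix-symmetric family lies,
for one `c` and all `n`, in the one-sorted narrow span `U_c(n)`" is false (the permanent is matrix-symmetric).
[cite: DawarWilsenach2025, Thm. 7.1 (p. 18)] -/
theorem diNarrowSpan_false_for_matrixSymmetric :
    ¬ ∀ f : (n : ℕ) → MvPolynomial (Fin n × Fin n) ℂ,
      (∀ (n : ℕ) (σ τ : Equiv.Perm (Fin n)),
        rename (fun p : Fin n × Fin n => (σ p.1, τ p.2)) (f n) = f n) →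
      ∃ c : ℕ, ∀ n : ℕ, f n ∈ Submodule.span ℂ {q : MvPolynomial (Fin n × Fin n) ℂ |
        ∃ (a : ℕ) (D : Multiset (Fin a × Fin a)),
          treewidth (SimpleGraph.fromRel fun u v : Fin a => ∃ e ∈ D, u = e.1 ∧ v = e.2) ≤
            (Nat.log 2 n + c) ^ c ∧ q = diHomPoly D n ℂ} := by
  intro h
  have hsymm : ∀ (n : ℕ) (σ τ : Equiv.Perm (Fin n)),
      rename (fun p : Fin n × Fin n => (σ p.1, τ p.2)) (perPoly (Fin n) ℂ) = perPoly (Fin n) ℂ := by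
    intro n σ τ
    have h' := congrArg (MvPolynomial.map (Complex.ofRealHom.comp NNReal.toRealHom))
      (MonotoneRestorationQP.Negative.rename_perm_perPoly n σ τ)
    rw [MvPolynomial.map_rename, map_perPoly] at h'
    exact h'
  obtain ⟨c, hc⟩ := h (fun n => perPoly (Fin n) ℂ) hsymm
  exact perPoly_not_mem_diNarrowSpan c hc

/-! ### The one-sorted narrow span is not Reynolds-stable -/

/-- ★ **THE ONE-SORTED NARROW SPAN IS NOT REYNOLDS-STABLE, AT ANY POLYLOGARITHMIC LOSS.**  For every `c` there are a
level `n` and a LOOP pattern (vertex `j` carries `m j` loops; treewidth `0`, so its `dihom` — a product of diagonal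
power sums — lies in `U_0(n)`) whose `Sym_n × Sym_n` Reynolds sum does NOT lie in `U_c(n)`: otherwise every `per_n`
would (`ReynoldsDescentFalse.perPoly_mem_of_reynolds_loopPatterns_mem`), against `perPoly_not_mem_diNarrowSpan`.
[cite: DawarWilsenach2025, Thm. 7.1 (p. 18)] -/
theorem exists_loopPattern_reynolds_not_mem_diNarrowSpan (c : ℕ) :
    ∃ (n k : ℕ) (m : Fin k → ℕ),
      (∑ g : Equiv.Perm (Fin n) × Equiv.Perm (Fin n),
          rename (fun ij : Fin n × Fin n => (g.1 ij.1, g.2 ij.2))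
            (diHomPoly (∑ j : Fin k, Multiset.replicate (m j) (j, j) : Multiset (Fin k × Fin k)) n ℂ)) ∉
        Submodule.span ℂ {q : MvPolynomial (Fin n × Fin n) ℂ |
          ∃ (a : ℕ) (D : Multiset (Fin a × Fin a)),
            treewidth (SimpleGraph.fromRel fun u v : Fin a => ∃ e ∈ D, u = e.1 ∧ v = e.2) ≤
              (Nat.log 2 n + c) ^ c ∧ q = diHomPoly D n ℂ} := by
  by_contra h
  refine perPoly_not_mem_diNarrowSpan c fun n =>
    ReynoldsDescentFalse.perPoly_mem_of_reynolds_loopPatterns_mem n _ fun k m => ?_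
  by_contra hkm
  exact h ⟨n, k, m, hkm⟩

/-- The same, packaged as the failure of "Reynolds-stability with polylog loss": it is NOT the case that for every
`c` some `c'` makes the Reynolds sum of every `dihom_{D,n}` with `tw D ≤ (log₂ n + c)^c` a member of `U_{c'}(n)`
(already `c = 0` fails).  Companion of `ReynoldsDescentFalse.not_reynoldsDescent` (target `W_{c'}(n)`).
[cite: DawarWilsenach2025, Thm. 7.1 (p. 18)] -/
theorem not_reynolds_diNarrowSpan_stable :
    ¬ ∀ c : ℕ, ∃ c' : ℕ, ∀ (n a : ℕ) (D : Multiset (Fin a × Fin a)),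
      treewidth (SimpleGraph.fromRel fun u v : Fin a => ∃ e ∈ D, u = e.1 ∧ v = e.2) ≤
        (Nat.log 2 n + c) ^ c →
      (∑ g : Equiv.Perm (Fin n) × Equiv.Perm (Fin n),
          rename (fun ij : Fin n × Fin n => (g.1 ij.1, g.2 ij.2)) (diHomPoly D n ℂ)) ∈
        Submodule.span ℂ {q : MvPolynomial (Fin n × Fin n) ℂ |
          ∃ (a' : ℕ) (D' : Multiset (Fin a' × Fin a')),
            treewidth (SimpleGraph.fromRel fun u v : Fin a' => ∃ e ∈ D', u = e.1 ∧ v = e.2) ≤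
              (Nat.log 2 n + c') ^ c' ∧ q = diHomPoly D' n ℂ} := by
  intro hR
  obtain ⟨c', hc'⟩ := hR 0
  obtain ⟨n, k, m, hnot⟩ := exists_loopPattern_reynolds_not_mem_diNarrowSpan c'
  refine hnot (hc' n k _ ?_)
  rw [pow_zero]
  exact (ReynoldsDescentFalse.treewidth_loopPattern_le m).trans zero_le_one

end PerNotDiNarrow

end Summit.ValiantsHypothesis.ValiantsHypothesis.Theorems

end
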